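import Literature.AnabelianGeometry.EtaleTheta.SettingModelTateGroupLevel
import Literature.AnabelianGeometry.EtaleTheta.SettingModelTateCusp
import HarnessLib

/-!
# Root models of [EtTh] §1, R78 STAGE 2 with a CUSP (abc-iut-w5-d249's `curveχq′ p i j`): the [SemiAnbd] §6 group-level
# package and the η′-consequences at the cusped Tate-shear carrier — UNCONDITIONAL (proof-only)

Mochizuki, *Semi-graphs of anabelioids*, Publ. RIMS **42** (2006) [SemiAnbd], Ex. 3.10 pp. 43–45, §6 p. 69 («`1 → π₁^temp(X_K̄)
→ π₁^temp(X_K) → G_K → 1`»), p. 71 («`D_x` … compact»), p. 73 («the ∧ denotes profinite completion») [cite: MochizukiSemiAnbd2006,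
§6 p.71]; [EtTh] §1 p. 13 («any decomposition group of a cusp») [cite: MochizukiEtTh2009, §1 p.13].  abc-iut cell, seat
abc-iut-w5-d111 (gen 4); R78 cluster STAGE 2 (S2).  PROOF-ONLY (0 definitions): the twin of this seat's
`SettingModelChiCuspGroupLevel` (p433631) at abc-iut-w5-d249's stage-2 cusp datum `SettingModelTateCusp` (`curveχq′ p i j` =
`curveχq p i j` with one cusp whose decomposition group is `b^Ẑ ⋊ G_{ℚ_p}`; same `K`, `Π^tp`, `aug`, `Π`, `toHat`):

* **`nonempty_groupLevelData_curveχq'_holds`** — abc-iut-L3's parameter bundle inhabited at `curveχq′` (fields transferred from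
  `curveχq` along `curveχq'_PiTemp` = `rfl`); `exists_toTemperedArithmeticGroup_curveχq'_holds`;
* **`isCompact_decomp_curveχq'`** / `decompCompact_curveχq'` / **`isCompact_cuspDecompχq`** — the stage-2 cusp decomposition group
  `b^Ẑ ⋊ G_{ℚ_p}` is COMPACT (this seat's `TemperedCurve.isCompact_decomp_of_isTempered`, p417615);
* `isOpenMap_aug_curveχq''`, **`ker_augHat_eq_deltaHat_curveχq'`** ((P1) of `OncePuncturedData`),
  **`isProfiniteCompletion_deltaToHat_curveχq'`**.
With abc-iut-w5-d249's (P2)–(P4) (`exists_isCusp_curveχq'`, `gfpSnd_left_eq_one_of_mem_decomp_curveχq'`,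
`map_aug_decomp_curveχq'`) only the guard (P5) separates a `ThetaSetting` over `curveχq′` from a fully inhabited
`OncePuncturedData` (sequel once abc-iut-L2-t5's F5q `modelχq` lands).
HONEST LABEL: semi-synthetic model (not the tempered `π₁` of a curve; synthetic cusp with Tate-twisted `b`-axis inertia) —
consistency evidence only; classical topological group theory; nothing of [EtTh]/[SemiAnbd] asserted; no side taken on
[IUTchIII] Cor. 3.12.
-/

noncomputable section

namespace Literature.AnabelianGeometry.EtaleTheta.SettingModel

open Literature.AnabelianGeometry.SemiGraphs Literature.AlgebraicGeometry.Frobenioids _root_.Topology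

variable (p : ℕ) [Fact p.Prime] (i j : ℤ)

/-! ### The bundle at the cusped stage-2 carrier -/

/-- **`GroupLevelData (curveχq′ p i j)` is inhabited, unconditionally** (same `K`, `Π^tp`, `aug` as `curveχq`, `rfl`).
[cite: MochizukiSemiAnbd2006, Ex 3.10 p.45] -/
theorem nonempty_groupLevelData_curveχq'_holds : Nonempty (TemperedCurve.GroupLevelData (curveχq' p i j)) := by
  have hker : ((curveχq' p i j).augK (curveχq' p i j).galoisIdentification).toMonoidHom.ker =
      (curveχq' p i j).DeltaTemp := (curveχq' p i j).ker_augK _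
  have hΔ : (curveχq' p i j).DeltaTemp = (curveχq p i j).DeltaTemp := rfl
  refine ⟨{ galEquiv := (curveχq' p i j).galoisIdentification
            isTempered := isTempered_piTemp_curveχq p i j
            isTempered_ker := by rw [hker, hΔ]; exact isTempered_deltaTemp_curveχq p i j
            isSlimGroup := isSlimGroup_PiTpχq p i j
            isSlimGroup_ker := by rw [hker, hΔ]; exact isSlimGroup_deltaTempχq p i j
            secondCountableTopology := secondCountableTopology_PiTpχq p i j }⟩

/-- The bridge of ruling η fires at the cusped stage-2 carrier. [cite: MochizukiSemiAnbd2006, Ex 3.10 p.43] -/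
theorem exists_toTemperedArithmeticGroup_curveχq'_holds :
    ∃ d : TemperedCurve.GroupLevelData (curveχq' p i j),
      ((curveχq' p i j).toTemperedArithmeticGroup d).Pi = PiTpχq p i j :=
  ⟨(nonempty_groupLevelData_curveχq'_holds p i j).some, rfl⟩

/-! ### η′-consequences: compact cusp decomposition group, open augmentation, exactness, completion -/

/-- **The decomposition group of the cusp of `curveχq′` is COMPACT** ([SemiAnbd] §6 p. 71): this seat's
`TemperedCurve.isCompact_decomp_of_isTempered` at the tempered, Galois-countable stage-2 `Π^tp_X`.
[cite: MochizukiSemiAnbd2006, §6 p.71] -/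
theorem isCompact_decomp_curveχq' (x : (curveχq' p i j).Pt) :
    IsCompact ((curveχq' p i j).decomp x : Set (curveχq' p i j).PiTemp) := by
  haveI : SecondCountableTopology (curveχq' p i j).PiTemp := secondCountableTopology_PiTpχq p i j
  exact (curveχq' p i j).isCompact_decomp_of_isTempered (isTempered_piTemp_curveχq p i j) x

/-- `Thm68Sub.DecompCompact (curveχq′ p i j)` (T68-B1) holds. [cite: MochizukiSemiAnbd2006, §6 p.71] -/
theorem decompCompact_curveχq' : Thm68Sub.DecompCompact (curveχq' p i j) :=
  (curveχq' p i j).decompCompact_of_groupLevelData (nonempty_groupLevelData_curveχq'_holds p i j).some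

/-- **The stage-2 cusp decomposition group `b^Ẑ ⋊ G_{ℚ_p} ≤ Γ ⋊_{actχq} G_{ℚ_p}` is compact** (abc-iut-w5-d249's
`cuspDecompχq p i j`, `= (curveχq′ p i j).decomp ()` by `rfl`). [cite: MochizukiSemiAnbd2006, §6 p.71] -/
theorem isCompact_cuspDecompχq : IsCompact (cuspDecompχq p i j : Set (PiTpχq p i j)) :=
  isCompact_decomp_curveχq' p i j ()

/-- The augmentation of `curveχq′` is an open map (open-mapping route through the bundle).
[cite: MochizukiSemiAnbd2006, §6 p.69] -/
theorem isOpenMap_aug_curveχq'' : IsOpenMap (curveχq' p i j).aug :=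
  (curveχq' p i j).isOpenMap_aug_of_groupLevelData (nonempty_groupLevelData_curveχq'_holds p i j).some

/-- **Exactness of `1 → Δ_X → Π_X → G_K` at `curveχq′`**: `Ker(augHat) = Δ_X` — field (P1) of `OncePuncturedData`
(abc-iut-w5-d139's `TemperedCurve.ker_augHat_eq_deltaHat` at the bundle). [cite: MochizukiSemiAnbd2006, §6 p.69] -/
theorem ker_augHat_eq_deltaHat_curveχq' :
    (curveχq' p i j).augHat.toMonoidHom.ker = (curveχq' p i j).DeltaHat :=
  (curveχq' p i j).ker_augHat_eq_deltaHat (nonempty_groupLevelData_curveχq'_holds p i j).some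

/-- **`Δ_X` is the profinite completion of `Δ^tp_X` at `curveχq′`** ([SemiAnbd] §6 p. 73).
[cite: MochizukiSemiAnbd2006, §6 p.73] -/
theorem isProfiniteCompletion_deltaToHat_curveχq' : IsProfiniteCompletion (curveχq' p i j).deltaToHat :=
  (curveχq' p i j).isProfiniteCompletion_deltaToHat (nonempty_groupLevelData_curveχq'_holds p i j).some

end Literature.AnabelianGeometry.EtaleTheta.SettingModel

end
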